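import Literature.IUT.LogThetaLattice.VerticallyCoricLGP
import Literature.IUT.LogThetaLattice.HolomorphicLogShellsProofs
import HarnessLib

/-!
# [IUTchIII] Proposition 3.5 (ii) (a) "(Nonarchimedean Primes)" at the GENUINE `p`-adic logarithm — proof-only
# companion of `VerticallyCoricLGP.lean` (abc-iut cell, layer L6, slice [IUTchIII] §3)

S. Mochizuki, *Inter-universal Teichmüller theory III*, kurims manuscript (May 2020), §3, Proposition 3.5
(ii) (a), pp. 104–105, read on the page [claim: Mochizuki2012, status: disputed]: "For `v_ℚ ∈ 𝕍^non_ℚ`, the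
topological module `𝓘(^{S^±_{j+1}}𝓕(^{n,∘}𝔇_≻)_{v_ℚ})` … contains the images of the submodules of Galois
invariants … of the groups of units `(Ψ_cns(^{n,m}𝔉_≻)_{|t|})^×_v`, for `𝕍 ∋ v | v_ℚ` and `|t| ∈ {0, …, j}`,
via both (1) the tensor product, over such `|t|`, of the [relevant] Kummer isomorphisms of (i), and (2) the
tensor product, over such `|t|`, of the pre-composite of these Kummer isomorphisms with the `m'`-th
iterates [cf. Remark 1.1.1] of the log-links, for `m' ≥ 1`, of the `n`-th column … [cf. the discussion of
Remark 1.2.2, (i), (iii)]."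

The statement file `VerticallyCoricLGP.lean` (abc-iut-L6-t4, p403950/p406711) types this clause over
abstract data as `Prop35ii_a I U κ lam` (coric shell `I ⊆ X`; unit groups `U m` with Kummer maps `κ m`;
the `m'`-th log-iterate pre-composites as PARTIAL maps `lam m m'`); its companion
`VerticallyCoricLGPProofs.lean` (abc-iut-L6-t6) records it as a SLOT ("nothing to prove before the merge");
the Cor. 3.12 crew consumes it as the non-archimedean clause of (Ind3)
(`Summit.ABC.IUTFork.Thm311.Column.ind3_non_of_prop35ii_a`, abc-iut-c312-1 `Thm311Dictionary`).

This file DISCHARGES the clause at ONE PLACE and ONE TENSOR FACTOR (`j = 0`, one `v | v_ℚ`) — the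
local content from which the packet-level statement is assembled by tensor product — at the level of the
tree's models of the log-link:

* `prop35ii_a_of_preLogShell_subset` — for ANY model `L : PadicLogOnUnits K` of the `p_v`-adic logarithm
  on the units of an ultrametric field (abc-iut-L4-t3, [AbsTopIII] Def. 5.4 (iii)) whose pre-log-shell
  lies in its log-shell (`ℐ* = log(𝒪^×) ⊆ ℐ = (p*)⁻¹·ℐ*`, [IUTchIII] Prop. 1.2 (v) (c^{non})): with coric
  module `X := K`, shell `I := ℐ_K` (`logShell L`), unit groups `U m := 𝒪_K^× = {‖x‖ = 1}` for every `m`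
  (vertical coricity: one and the same étale-like shell for the whole column, [IUTchIII] Prop. 3.5 (i)),
  Kummer maps `κ m := (𝒪_K^× ⊆ K)` (units of the Frobenius-like copy `(n, m)` read in the coric copy
  `(n, ∘)` via the Kummer isomorphism, [IUTchIII] Rmk. 1.2.2 (i): "`𝒪^× ⊆ 𝒪 ⊆ ℐ`"), and `lam m m'` := the
  `m'`-th iterate `log_K^{[m']}` of the log-link on the portion `D_{m'} ⊆ 𝒪_K^×` of the units where it is
  defined (abc-iut-L6-t3's `iterDomain`, [IUTchIII] Rmk. 1.1.1 (i)) and undefined (`none`) elsewhere —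
  `Prop35ii_a` HOLDS: clause (1) is abc-iut-L4-t3's `closedBall_subset_logShell` (`𝒪_K ⊆ ℐ_K`), clause (2)
  is abc-iut-L6-t3's "upper semi-commutativity" `iterate_image_subset_logShell` ([IUTchIII] Rmk. 1.2.2
  (iii)).
* `prop35ii_a_ofUnitLog` — UNCONDITIONALLY at the standard model `PadicLogOnUnits.ofUnitLog p K`
  (abc-iut-L3-t11 / abc-iut-S1's real `p`-adic logarithm `log_p : 𝒪_K^× → K` of a mixed-characteristic
  nonarchimedean local field `K`, `[NormedAlgebra ℚ_[p] K] [IsUltrametricDist K] [ProperSpace K]`), the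
  hypothesis `ℐ* ⊆ ℐ` being abc-iut-L6-d2's `preLogShell_subset_logShell_ofUnitLog`.

Deliberately NOT here (named): the PACKET-level statement (tensor product over `|t| ∈ {0, …, j}` and
direct sum over `v | v_ℚ` inside `𝓘(^{S^±_{j+1}}𝓕(^{n,∘}𝔇_≻)_{v_ℚ})`: abc-iut-L6-t4 `TensorPackets.shellPacketN`,
abc-iut-c312-5 `Thm311.LogShells.shellPk` = the additive closure of pure tensors of shell elements —
pure tensors of elements of `ℐ_{K_v}` lie in it by construction, so the lift is bookkeeping over the
packet signature, owner abc-iut-c312-5 `Real.logShells`); clause (b) (archimedean, the closed ball of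
radius `π` in the universal covering `Ψ^∼`, Def. 1.1 (ii)) and clause (c) (bad primes). No new
definitions; classical `p`-adic analysis only; nothing here bears on the disputed [IUTchIII] Cor. 3.12 or
takes a side; typed ≠ discharged elsewhere.
-/

noncomputable section

namespace Literature.IUT.LogThetaLattice

open Set Metric Literature.AnabelianGeometry.AbsoluteAnabelian

universe u

section Model

variable {K : Type u} [NontriviallyNormedField K] [IsUltrametricDist K] (L : PadicLogOnUnits K)

open Classical in
/-- **IUTchIII:Prop3.5(ii)(a)** (kurims pp. 104–105) at one nonarchimedean place and one tensor factor,
over ANY model `L` of the `p_v`-adic logarithm on units with `ℐ* ⊆ ℐ`: the coric log-shell `ℐ_K` contains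
(1) the units `𝒪_K^×` read in the coric copy via the Kummer isomorphism (`𝒪^× ⊆ 𝒪 ⊆ ℐ`, Rmk. 1.2.2 (i)) and
(2) the images of the portions of `𝒪_K^×` on which the `m'`-th iterates (`m' ≥ 1`) of the log-link are
defined (Rmk. 1.1.1 (i), Rmk. 1.2.2 (iii) "upper semi-commutativity") — i.e. abc-iut-L6-t4's
`Prop35ii_a` HOLDS for `I := logShell L`, `U m := 𝒪_K^×`, `κ m :=` inclusion, `lam m m' :=` the partial
`m'`-th log-iterate. [claim: Mochizuki2012, status: disputed] -/
theorem prop35ii_a_of_preLogShell_subset (hc : preLogShell L ⊆ logShell L) :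
    Prop35ii_a (logShell L) (fun _ : ℤ => ↥(sphere (0 : K) 1)) (fun _ u => (u : K))
      (fun _ (m' : ℕ) _ u =>
        if (u : K) ∈ iterDomain L m' then some (L.log^[m'] (u : K)) else none) := by
  refine ⟨fun m u => ?_, fun m m' hm u x hx => ?_⟩
  · exact closedBall_subset_logShell L (sphere_subset_closedBall u.2)
  · dsimp only at hx
    split_ifs at hx with hu
    obtain ⟨k, rfl⟩ : ∃ k, m' = k + 1 := ⟨m' - 1, by omega⟩
    rw [Option.some.injEq] at hx
    subst hx
    exact iterate_image_subset_logShell L hc k ⟨u, hu, rfl⟩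

end Model

section Standard

variable (p : ℕ) [Fact p.Prime]
variable (K : Type u) [NontriviallyNormedField K] [NormedAlgebra ℚ_[p] K] [IsUltrametricDist K]
  [ProperSpace K]

open Classical in
/-- **IUTchIII:Prop3.5(ii)(a)** (kurims pp. 104–105) at one nonarchimedean place and one tensor factor,
UNCONDITIONALLY at the genuine `p`-adic logarithm `log_p : 𝒪_K^× → K` of a mixed-characteristic local field
`K` (the standard model `PadicLogOnUnits.ofUnitLog p K`): abc-iut-L6-t4's `Prop35ii_a` HOLDS for the coric
log-shell `ℐ_K = (p*)⁻¹·log_p(𝒪_K^×)`, the units `𝒪_K^×` with their inclusion as Kummer maps, and the partial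
iterates of `log_p` — the hypothesis `ℐ* ⊆ ℐ` of `prop35ii_a_of_preLogShell_subset` being abc-iut-L6-d2's
`preLogShell_subset_logShell_ofUnitLog`. [claim: Mochizuki2012, status: disputed] -/
theorem prop35ii_a_ofUnitLog :
    Prop35ii_a (logShell (PadicLogOnUnits.ofUnitLog p K)) (fun _ : ℤ => ↥(sphere (0 : K) 1))
      (fun _ u => (u : K))
      (fun _ (m' : ℕ) _ u =>
        if (u : K) ∈ iterDomain (PadicLogOnUnits.ofUnitLog p K) m' then
          some ((PadicLogOnUnits.ofUnitLog p K).log^[m'] (u : K)) else none) :=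
  prop35ii_a_of_preLogShell_subset _ (preLogShell_subset_logShell_ofUnitLog p K)

end Standard

end Literature.IUT.LogThetaLattice
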